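import Summits.NavierStokesRegularity.NavierStokesRegularity.Theorems.ScalingDefectPeepholeDoorDefs
import Summits.NavierStokesRegularity.NavierStokesRegularity.Theorems.RellichScarApexLocalisationIrrotHalfspaceLiouville
import Literature.Analysis.FluidPDE.ConstantinFeffermanEnstrophySlab
import Literature.Analysis.FluidPDE.NSLocalAnalyticityRadius

/-!
# QuietScarPocketDoorDefs — door S31 «QuietScarPocketDoor»: texts + kernel-checked support (plate P0)

Texts of record: nsreg-p1 g25 `r29/Sketch31.lean` v2.1 sha16 363b5766493b6c28 (ROUND-29 v2.1 5a5a841e25b902a3), Part A,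
VERBATIM (every `def … : Prop` below is byte-identical to the sketch; the proved support theorems are copied with their
proofs).  The three COMPOSITIONS of the sketch (`pvScarPocketRegularity_of`, `pvScarPocketRegularity_of_local`,
`targetScarPocket_of`) are NOT here — they land with the LEAD's `Theorems/QuietScarPocketDoorDoor.lean`; Part B of the
sketch (door S30 addendum `QuietVortexCoreRigidityU`) is not part of this plate.  Landed by ns-s29-p2 g3 per DIRECTOR-NS
#192 (2) / nsreg-p1 g25 plate order 2026-08-28T09:22:14Z, `--supports stmt-NavierStokesRegularity-0056 --as helper`.

**Door S31 (terminal-trace pocket door).**  At a point `(x₀,T)` where a classical Navier–Stokes solution is locally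
ONE-POINT Type I (`‖u(t,x)‖(‖x−x₀‖ + √(ν(T−t))) ≤ M`), if the final-time vorticity is SCALE-CRITICALLY QUIET on ONE pocket
`B(x₁, κ‖x₁−x₀‖)` hanging off ONE point `x₁ ≠ x₀` close to `x₀` — `‖x₁−x₀‖² ‖ω(t,x)‖ ≤ ν ε(M,κ)` on the pocket, eventually
as `t ↑ T`, per point (trace-free rendering) — then `(x₀,T)` is regular.  CHAIN: K1 `ScarPocketZoom` (class zoom at the
pocket scale) + LEG F `TerminalTraceAnalytic` (the blow-up limit's top curl trace is real-analytic off the apex; local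
physical forms `TerminalSliceAnalyticity` / `TerminalSliceVelocityAnalyticity`, PF split `TerminalTraceC1` +
`TerminalUniformRadius` + `AnalyticOfBoundedHolomorphicLimit` with `terminalSliceVelocityAnalyticity_of_split` PROVED) + K2
`TracelessScarLiouville` (= the tree theorem
`RellichScarApexLocalisationIrrotHalfspaceLiouville.not_isBackwardSingularPoint_of_topCurlVanishing_halfspace`, PROVED here as
`tracelessScarLiouville_holds`) ⟹ `PVScarPocketRegularity` ⟹ (frame transfer `FrameTransferS31`) `TargetScarPocket`.
Identity-theorem tools for the composition: `isPreconnected_compl_zero`, `trace_eq_zero_of_pocket`; quantifier sanity: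
`pocket_of_curl_eventually_zero`.  Sources and «why it might fail» are in the individual docstrings (sketch text).

WHAT THIS IS NOT: not NS regularity — item 0056 `NoTypeII` stays OPEN; the door is a regularity CRITERION inside a
HYPOTHETICAL one-point Type-I blow-up; every open statement is a `def … : Prop` (no proof placeholders); nothing here is a
route or a summit statement.
-/

noncomputable section

set_option linter.dupNamespace false

/-! ## Part A — door S31 -/

namespace Summit.NavierStokesRegularity.NavierStokesRegularity.Theorems.QuietScarPocketDoor

open MeasureTheory Set Function Filter Topology TopologicalSpace Metric
open scoped RealInnerProductSpace InnerProductSpace NNReal ENNReal Topology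
open Literature.Analysis Literature.Analysis.FluidPDE
open Summit.NavierStokesRegularity.NavierStokesRegularity.Theorems.RellichScarApexLocalisationIrrotHalfspaceLiouville
  (not_isBackwardSingularPoint_of_topCurlVanishing_halfspace)
open Literature.Analysis.FunctionSpaces.EuclideanSpace (complexify)

local notation "E³" => EuclideanSpace ℝ (Fin 3)

/-! ### §1 The door texts -/

/-- **door S31 in the Pineau–Vicol frame at `(C_u, κ)`** (`ν = 1`, region `[−1,0) × B₁`, apex `(0,0)`): an `ε > 0`, and for
every shell-pressure level `C_p` a pocket-scale threshold `r₁ > 0`, such that a classical solution on the region with the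
ONE-POINT Type-I bound `‖u(t,x)‖ ≤ C_u/(√(−t)+‖x‖)` and `|p| ≤ C_p` on the shell `½ < ‖x‖ < ¾`, whose vorticity is
terminally `ε`-quiet at the critical rate on ONE pocket `B(x₁, κ‖x₁‖)`, `0 < ‖x₁‖ ≤ r₁` —
`‖x₁‖²‖curl u(t,x)‖ ≤ ε` for all `t < 0` close to `0` (closeness may depend on `x`) — is regular at `(0,0)`
(bounded on some `B_ϱ × (−ϱ²,0)`).  The terminal trace is not named: «eventually as `t ↑ 0`» is its trace-free rendering. -/
def PVScarPocketRegularityAt (Cu κ : ℝ) : Prop :=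
  ∃ ε : ℝ, 0 < ε ∧ ∀ Cp : ℝ, 0 < Cp → ∃ r₁ : ℝ, 0 < r₁ ∧
    ∀ (u : ℝ → E³ → E³) (p : ℝ → E³ → ℝ),
      IsClassicalNSSolutionOnRegion (Ico (-1 : ℝ) 0 ×ˢ ball (0 : E³) 1) 1 0 u p →
      (∀ t ∈ Ico (-1 : ℝ) 0, ∀ x ∈ ball (0 : E³) 1, ‖u t x‖ ≤ Cu / (Real.sqrt (-t) + ‖x‖)) →
      (∀ t ∈ Ico (-1 : ℝ) 0, ∀ x : E³, 1 / 2 < ‖x‖ → ‖x‖ < 3 / 4 → |p t x| ≤ Cp) →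
      (∃ x₁ : E³, 0 < ‖x₁‖ ∧ ‖x₁‖ ≤ r₁ ∧
        ∀ x ∈ ball x₁ (κ * ‖x₁‖), ∀ᶠ t in 𝓝[<] (0 : ℝ), ‖x₁‖ ^ 2 * ‖curl (u t) x‖ ≤ ε) →
      ∃ ϱ : ℝ, 0 < ϱ ∧ ∃ B : ℝ, ∀ t : ℝ, -ϱ ^ 2 < t → t < 0 → ∀ x ∈ ball (0 : E³) ϱ, ‖u t x‖ ≤ B

/-- **door S31 in the Pineau–Vicol frame:** every Type-I constant, every pocket aperture `κ ∈ (0,1)`. -/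
def PVScarPocketRegularity : Prop :=
  ∀ Cu : ℝ, 0 < Cu → ∀ κ : ℝ, 0 < κ → κ < 1 → PVScarPocketRegularityAt Cu κ

/-- **door S31 at `(ν, M, κ)` in the physical frame** (class of S29 `TargetPeepholeVorticityAt`: classical on `[0,T)`,
Leray–Hopf from a rapidly decaying datum with kinetic energy `≤ E₀`, local one-point Type I(`M`) on `Q_ρ(x₀,T)`): some
`ε > 0` such that for every class `(T, ρ, E₀)` there is ONE pocket-scale threshold `r₁ > 0` with: terminal vorticity
`‖x₁−x₀‖²‖curl u(t,x)‖ ≤ ν ε` eventually as `t ↑ T` on ONE pocket `B(x₁, κ‖x₁−x₀‖)`, `0 < ‖x₁−x₀‖ ≤ r₁`, excludes the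
singularity at `(x₀,T)`. -/
def TargetScarPocketAt (ν M κ : ℝ) : Prop :=
  ∃ ε : ℝ, 0 < ε ∧ ∀ (T ρ E₀ : ℝ), 0 < T → 0 < ρ → ∃ r₁ : ℝ, 0 < r₁ ∧
    ∀ (u : ℝ → E³ → E³) (p : ℝ → E³ → ℝ),
    IsClassicalNSSolutionOn (Set.Ico 0 T) ν 0 u p → IsLerayHopfOn T ν 0 (u 0) u → HasRapidSpatialDecay (u 0) →
    VectorCalculus.kineticEnergy (u 0) ≤ E₀ →
    ∀ (x₀ : E³),
    (∀ t ∈ Set.Ico 0 T, T - ρ ^ 2 < t → ∀ x ∈ ball x₀ ρ, ‖u t x‖ * (‖x - x₀‖ + Real.sqrt (ν * (T - t))) ≤ M) →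
    (∃ x₁ : E³, 0 < ‖x₁ - x₀‖ ∧ ‖x₁ - x₀‖ ≤ r₁ ∧
      ∀ x ∈ ball x₁ (κ * ‖x₁ - x₀‖), ∀ᶠ t in 𝓝[<] T, ‖x₁ - x₀‖ ^ 2 * ‖curl (u t) x‖ ≤ ν * ε) →
    IsBackwardBoundedAt u T x₀

/-- **door S31 (physical frame):** every viscosity, every Type-I constant, every aperture `κ ∈ (0,1)`. -/
def TargetScarPocket : Prop :=
  ∀ (ν : ℝ), 0 < ν → ∀ (M κ : ℝ), 0 < κ → κ < 1 → TargetScarPocketAt ν M κ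

/-- **FRAME TRANSFER (support, routine; the S29 FILE 4 / S30 `Frame` pattern):** translation to `(x₀,T) ↦ (0,0)`, parabolic
rescaling to the unit Type-I cylinder, viscosity normalisation `ν ↦ 1`; the shell pressure level `C_p(ν,M,T,ρ,E₀)` from the
Leray–Hopf class (local pressure representation); the pocket hypothesis and the conclusion are scale-covariant
(`‖x₁−x₀‖²‖ω‖/ν` is dimensionless; `IsBackwardBoundedAt` ⇐ bounded on a backward cylinder). -/
def FrameTransferS31 : Prop := PVScarPocketRegularity → TargetScarPocket

/-! ### §2 The limit-class texts (backward slab `(−∞,0) × ℝ³`, `ν = 1`; vocabulary of the tree's RellichScar engines) -/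

/-- The open backward slab `(-∞, 0) × ℝ³` (time first). -/
local notation "𝕊" => Literature.Analysis.FluidPDE.slab (EuclideanSpace ℝ (Fin 3)) (Set.Iio (0 : ℝ)) isOpen_Iio

/-- **OFF-APEX TOP CONVERGENCE of the curl of a representative `Uc` to a trace `Ω₀`** — locally uniformly near every point of
the punctured space: for `x₁ ≠ 0` and `θ > 0` some `s₀ ∈ [−1,0)`, `δ > 0` with `‖curl Uc(s,x) − Ω₀(x)‖ ≤ θ` for
`s ∈ (s₀,0)`, `x ∈ B(x₁,δ)` (shape of the hypothesis `htopc` of the tree's S15 theorem, with `0` replaced by `Ω₀`). -/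
def TopCurlTendsto (Uc : ℝ → E³ → E³) (Ω₀ : E³ → E³) : Prop :=
  ∀ x₁ : E³, x₁ ≠ 0 → ∀ θ : ℝ, 0 < θ → ∃ s₀ δ : ℝ, s₀ < 0 ∧ (-1 : ℝ) ≤ s₀ ∧ 0 < δ ∧
    ∀ s ∈ Ioo s₀ 0, ∀ x ∈ ball x₁ δ, ‖curl (Uc s) x - Ω₀ x‖ ≤ θ

/-- **OFF-APEX CLASSICAL DATA of a representative** (what LEG F consumes): on `(−1,0) × (ℝ³∖{0})` the representative `Uc` is,
with some pressure `q`, a classical Navier–Stokes solution (`ν = 1`, no force), obeys the one-point Type-I bound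
`‖Uc(s,x)‖ ≤ C/(‖x‖ + √(−s))` pointwise there, and `q` is bounded on every closed shell `δ ≤ ‖x‖ ≤ δ⁻¹` uniformly in
`s ∈ (−1,0)`. -/
def OffApexClassical (C : ℝ) (Uc : ℝ → E³ → E³) : Prop :=
  ∃ q : ℝ → E³ → ℝ,
    IsClassicalNSSolutionOnRegion (Ioo (-1 : ℝ) 0 ×ˢ ({0}ᶜ : Set E³)) 1 0 Uc q ∧
    (∀ s ∈ Ioo (-1 : ℝ) 0, ∀ x : E³, x ≠ 0 → ‖Uc s x‖ ≤ C / (‖x‖ + Real.sqrt (-s))) ∧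
    (∀ δ : ℝ, 0 < δ → ∃ P : ℝ, ∀ s ∈ Ioo (-1 : ℝ) 0, ∀ x : E³, δ ≤ ‖x‖ → ‖x‖ ≤ δ⁻¹ → |q s x| ≤ P)

/-- **K1 · CLASS ZOOM AT THE POCKET SCALE (`ScarPocketZoom`).**  If the door fails at `(C_u, κ)` then — along a sequence of
counterexamples `(u_k, p_k)` with `ε_k → 0` and pocket centres `x₁ᵏ → 0`, rescaled by `‖x₁ᵏ‖` and rotated to `x₁ᵏ/‖x₁ᵏ‖ ↦ e`
— there is a limit: a suitable weak solution `(w, π)` of unit-viscosity Navier–Stokes on the backward slab with a weak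
spatial gradient `H`, `𝐈 < ⊤`, the one-point (apex) Type-I bound a.e., BACKWARD SINGULAR at the origin (persistence of the
singularity through the limit: ε-regularity), together with a continuous representative `Uc` of `w` on `(−1,0) × (ℝ³∖{0})`
which is classical off the apex (`OffApexClassical`) and whose curls converge at the top, locally uniformly off the apex, to
a continuous trace `Ω₀` VANISHING ON THE POCKET `B(e,κ)` (the rescaled hypothesis `‖curl u_k(t,·)‖ ≤ ε_k‖x₁ᵏ‖⁻²` eventually,
passed through the uniform off-apex `C¹`-in-space / Lipschitz-in-time vorticity bounds up to the top).
[AlbrittonBarker2019 (arXiv:1811.00502) Prop. 2.3 / Lemma 2.2 (slab compactness: tree `slab_typeI_compactness`,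
`stub_classBlowupPersistence`); Seregin 2014 Ch. 6 (ε-regularity); the S15 zoom files `LocalIrrotationalScarDoorZoom*` for the
one-solution version.  why it might fail: only bookkeeping — the shell pressure level `C_p` must wash out under `‖x₁ᵏ‖ → 0`
(choose `r₁(C_p)` with `C_p r₁² ≤ 1`), exactly as in the S29/S30 transfers.] -/
def ScarPocketZoom : Prop :=
  ∀ Cu : ℝ, 0 < Cu → ∀ κ : ℝ, 0 < κ → κ < 1 → ¬ PVScarPocketRegularityAt Cu κ →
    ∃ (w : ℝ → E³ → E³) (π : ℝ → E³ → ℝ) (H : ℝ → E³ → E³ →L[ℝ] E³) (C : ℝ) (e : E³)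
      (Uc : ℝ → E³ → E³) (Ω₀ : E³ → E³),
      IsSuitableWeakSolutionOn 𝕊 1 0 w π ∧ HasWeakSpatialGradientOn 𝕊 w H ∧
      typeIBound (Iio (0 : ℝ) ×ˢ univ) w π H < ⊤ ∧
      (∀ᵐ z ∂(volume.restrict (Iio (0 : ℝ) ×ˢ (univ : Set E³))), ‖w z.1 z.2‖ ≤ C / (‖z.2‖ + Real.sqrt (-z.1))) ∧
      ‖e‖ = 1 ∧ IsBackwardSingularPoint w 0 ∧
      uncurry Uc =ᵐ[volume.restrict (Ioo (-1 : ℝ) 0 ×ˢ ({0}ᶜ : Set E³))] uncurry w ∧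
      ContinuousOn (uncurry Uc) (Ioo (-1 : ℝ) 0 ×ˢ ({0}ᶜ : Set E³)) ∧
      OffApexClassical C Uc ∧ ContinuousOn Ω₀ ({0}ᶜ : Set E³) ∧ TopCurlTendsto Uc Ω₀ ∧
      (∀ y ∈ ball e κ, Ω₀ y = 0)

/-- **LEG F (limit form) · TERMINAL-TRACE ANALYTICITY OFF THE APEX (`TerminalTraceAnalytic`).**  For a field `Uc` which is a
classical Navier–Stokes solution off the apex on `(−1,0) × (ℝ³∖{0})` with the one-point Type-I bound and locally bounded
pressure (`OffApexClassical`), any top trace `Ω₀` of its curls (`TopCurlTendsto`) is REAL-ANALYTIC on `ℝ³∖{0}`.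
(From `TerminalSliceAnalyticity` below on the balls `B(y, ‖y‖/8)`, `y ≠ 0`: there `‖Uc‖ ≤ 8C/(7‖y‖)`, `|q| ≤ P(‖y‖/2)`;
K1's `Ω₀` coincides on the ball with the local analytic curl trace by uniqueness of limits.)
[why it might fail: only through `TerminalSliceAnalyticity`.] -/
def TerminalTraceAnalytic : Prop :=
  ∀ (C : ℝ) (Uc : ℝ → E³ → E³) (Ω₀ : E³ → E³),
    OffApexClassical C Uc → TopCurlTendsto Uc Ω₀ → AnalyticOnNhd ℝ Ω₀ ({0}ᶜ : Set E³)

/-- **LEG F (local physical form) · TERMINAL-SLICE LOCAL ANALYTICITY (`TerminalSliceAnalyticity`)** — the first statement of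
the line NOT found in print or tree: a classical Navier–Stokes solution (`ν = 1`, no force) on `(a,0) × B(x_c, 4r)`, `a < 0`,
with `‖u‖ ≤ M` and `|p| ≤ P` there, has an ANALYTIC TERMINAL CURL TRACE on `B(x_c, r)`: there is a REAL-ANALYTIC
field `Ω₀` on `B(x_c, r)` with `curl u(t,x) → Ω₀(x)` as `t ↑ 0` (v1.1 — the weakest form the line consumes: v1's clauses
`u(t,x) → u₀(x)`, `Ω₀ = curl u₀` were true but unused downstream, K1/K2 read only the curl trace.  Compactness-free proof
shape: holomorphic extensions `U_t` of `u(t)` on a UNIFORM complex neighbourhood with a uniform bound for `t` near `0`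
(BGK restarted, below) ⇒ Cauchy estimates ⇒ `∂ₜω = Δω − curl(ω × u)` bounded near the top (pressure-free) ⇒ `curl u(t,·)`
uniformly Cauchy as `t ↑ 0` on the real ball ⇒ by the two-constants estimate (tree `norm_le_two_constants_of_real_diameter`,
S30 P1) the holomorphic curls `curl U_t` are locally uniformly Cauchy on a thinner complex neighbourhood ⇒ their limit is
holomorphic (tree `Literature.Analysis.Complex.SCV.differentiableOn_of_tendstoLocallyUniformlyOn`) with real restriction
`Ω₀` ⇒ `Ω₀` real-analytic; no Montel, no `∂ₜu`/`∇p` control).  TREE PATH (audit 2026-08-28): the ε-regularity module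
`exists_forall_norm_le_of_small` (NSLocalAnalyticityRadiusEpsReg) already bounds `u` on `Ico (1/16) (R²)` — up to the
window END; the contour Picard run `IsSchemeRun x₁ c s₀ t₁ …` is causal with region radius `c√(s − s₀)` and smallness
`C_B·2D₀·2√(t₁−s₀) ≤ 1/4`; the ONLY sub-terminal choice in `BGK2015.exists_small_unitScale_extension_norm_le` is the
fixed pair `(s₀,t₁) = (1/2, 3/2)` around the slice `t = 1` inside the window `Ioo (−δ) 12²` (coupled to the ball radius by
`IsCylinderSolution x₁ δ R`: window end `= R²`).  Terminal variant = slide `(s₀,t₁) ↦ (R² − 2ℓ, R²)` (or decouple the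
window end from `R²`), read off the extensions for all slices `t ∈ [R² − ℓ, R²)` on the common region
`region x₁ c (R²−2ℓ) (R²−ℓ)` with the uniform bound `ρ₀`, then Montel.  The top lid of a parabolic cylinder is
parabolic-interior: spatial analyticity there is CAUSAL (heat equation: classical; nonlinear local parabolic equations:
Kinderlehrer–Nirenberg 1978 / Komatsu 1979), and for Navier–Stokes the non-local part of the pressure inside the ball is
harmonic, hence analytic (the device of Kahane 1969 / Bradshaw–Grujić–Kukavica 2015).  The printed local radius theorem
(BGK 2015 Thm 2.3 = tree `bradshawGrujicKukavica2015_local_analyticity_radius_holds`) stops at `T₂ ≤ C⁻¹·T` strictly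
inside the smoothness window and does NOT reach the terminal slice; Lemarié-Rieusset 2016 Thm 9.12 (tree
`lemarieRieusset2016_local_analyticity_holds`) is global in space.  Harmonic parasites `a(t)∇h` do not threaten it (their
traces are gradients of harmonic functions, analytic; `|p| ≤ P` makes `a` Lipschitz so the trace exists).
[BradshawGrujicKukavica2015 (doi:10.1016/j.jde.2015.05.009) Thm 2.3 p. 4–5; Kahane 1969 ARMA 33; Masuda 1967; Komatsu 1979
CPAM 32; LemarieRieusset2016 Thm 9.12.  why it might fail: a genuinely terminal obstruction would have to come from the
non-local pressure driven by a region where `u` is NOT bounded (outside `B(x_c,4r)`): inside the ball that contribution is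
harmonic in `x` at each time and bounded (`|p| ≤ P`), so its `x`-derivatives on `B(x_c,2r)` obey Cauchy-type factorial bounds
uniformly up to `t = 0` — no obstruction is visible; the risk is the size of the re-run of the BGK contour scheme on windows
ENDING at the top (≈ the tree's 20-file `NSLocalAnalyticityRadius*` formalisation, adapted).] -/
def TerminalSliceAnalyticity : Prop :=
  ∀ (xc : E³) (r a M P : ℝ), 0 < r → a < 0 → 0 ≤ M → 0 ≤ P →
    ∀ (u : ℝ → E³ → E³) (p : ℝ → E³ → ℝ),
      IsClassicalNSSolutionOnRegion (Ioo a 0 ×ˢ ball xc (4 * r)) 1 0 u p →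
      (∀ t ∈ Ioo a 0, ∀ x ∈ ball xc (4 * r), ‖u t x‖ ≤ M) →
      (∀ t ∈ Ioo a 0, ∀ x ∈ ball xc (4 * r), |p t x| ≤ P) →
      ∃ Ω₀ : E³ → E³, AnalyticOnNhd ℝ Ω₀ (ball xc r) ∧
        (∀ x ∈ ball xc r, Tendsto (fun t => curl (u t) x) (𝓝[<] (0 : ℝ)) (𝓝 (Ω₀ x)))

/-- **SUPPORT · LEG F local ⇒ limit form** (routine: cover `ℝ³∖{0}` by the balls `B(y,‖y‖/8)`, `y ≠ 0` — there
`‖Uc‖ ≤ 8C/(7‖y‖)` and `|q| ≤ P(‖y‖/2)` on `(−1/2, 0) × B(y, ‖y‖/2)`; uniqueness of pointwise limits along `𝓝[<] 0`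
identifies K1's global trace `Ω₀` with the local analytic trace on each ball). -/
def TerminalTraceAnalyticOfLocal : Prop := TerminalSliceAnalyticity → TerminalTraceAnalytic

/-- **LEG F, VELOCITY-TRACE FORM (`TerminalSliceVelocityAnalyticity`)** — the cell's G2 «top-time local analyticity»
(nsreg-p1 ROUND-1 engine `ApexScarAnalytic`; ROUND-14 auxiliary `TopTimeLocalAnalyticity` of door S15, LIT-PACK §R7/§R10:
GAP IN PRINT), here with the shell pressure of the S29/S30 class added: the same hypotheses as `TerminalSliceAnalyticity`,
and the conclusion that the terminal VELOCITY trace exists pointwise on `B(x_c,r)`, is real-analytic, and the curls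
converge to its curl.  It implies the curl form (`terminalSliceAnalyticity_of_velocity`, proved) and is the form that
ALSO discharges the analyticity hypothesis of the tree's STAGED S15 LEVEL-2 theorem
`LocalIrrotationalScarDoorAnyWindow.localIrrotationalScarDoor_anyWindow` (exact irrotationality near ONE point of the
punctured final slice ⇒ backward bounded, CONDITIONAL on `AnalyticOnNhd ℝ (u T) (ball x₀ ρ \ {x₀})`).  Extra cost over the
curl form: `∂ₜu = Δu − (u·∇)u − ∇p` bounded near the top on `B(x_c,2r)` (Cauchy estimates for `u`; `∇p` = Newtonian part of
`χ∂ᵢ∂ⱼ(uᵢuⱼ)` + a harmonic remainder bounded by `P`, interior gradient estimate).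
[why it might fail: as `TerminalSliceAnalyticity`; the pressure hypothesis `|p| ≤ P` is what makes the velocity trace exist
(parasites `a(t)∇φ` with `a` merely bounded have no trace).] -/
def TerminalSliceVelocityAnalyticity : Prop :=
  ∀ (xc : E³) (r a M P : ℝ), 0 < r → a < 0 → 0 ≤ M → 0 ≤ P →
    ∀ (u : ℝ → E³ → E³) (p : ℝ → E³ → ℝ),
      IsClassicalNSSolutionOnRegion (Ioo a 0 ×ˢ ball xc (4 * r)) 1 0 u p →
      (∀ t ∈ Ioo a 0, ∀ x ∈ ball xc (4 * r), ‖u t x‖ ≤ M) →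
      (∀ t ∈ Ioo a 0, ∀ x ∈ ball xc (4 * r), |p t x| ≤ P) →
      ∃ u₀ : E³ → E³, AnalyticOnNhd ℝ u₀ (ball xc r) ∧
        (∀ x ∈ ball xc r, Tendsto (fun t => u t x) (𝓝[<] (0 : ℝ)) (𝓝 (u₀ x))) ∧
        (∀ x ∈ ball xc r, Tendsto (fun t => curl (u t) x) (𝓝[<] (0 : ℝ)) (𝓝 (curl u₀ x)))

/-- The velocity-trace form implies the curl-trace form (`Ω₀ := curl u₀`; the curl of an analytic field is analytic). -/
theorem terminalSliceAnalyticity_of_velocity (h : TerminalSliceVelocityAnalyticity) : TerminalSliceAnalyticity := by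
  intro xc r a M P hr ha hM hP u p hsol hu hp
  obtain ⟨u₀, hA, -, hcurl⟩ := h xc r a M P hr ha hM hP u p hsol hu hp
  refine ⟨curl u₀, ?_, hcurl⟩
  rw [curl_eq_curlCLM_comp_fderiv']
  exact curlCLM.comp_analyticOnNhd hA.fderiv

/-! ### PF split (v2.1; `r29/PF-AID.md`): TRACE (by name) + UNIFORM TERMINAL RADIUS (the crux) + SCV LIMIT (pure complex analysis)

Three support texts whose conjunction gives `TerminalSliceVelocityAnalyticity` (`terminalSliceVelocityAnalyticity_of_split`,
PROVED below), so that plate PF can be staffed as three independent pieces of very different kinds. -/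

/-- **PF-a `TerminalTraceC1` (support, S; BY NAME from `NSBoundedHigherRegularityBounds_holds` — Seregin–Šverák 2009 §2 — with
the vertex of the backward parabolic cylinder AT the terminal time, `z = (0, x')`, radius `min r √(−a)`, finitely many centres
`x' ∈ closedBall x_c (2r)`):** the terminal velocity trace exists with `C¹`-uniform convergence on `B(x_c,2r)`.  (Hölder continuity
in `(t,x)` of `V` and `D_xV` on a cylinder open at the top ⇒ uniformly Cauchy as `t ↑ 0`.)
[why it might fail: not expected to — it is the printed causal interior regularity; the pressure bound is genuinely needed (Serrin's
`a(t)∇φ`).] -/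
def TerminalTraceC1 : Prop :=
  ∀ (xc : E³) (r a M P : ℝ), 0 < r → a < 0 → 0 ≤ M → 0 ≤ P →
    ∀ (u : ℝ → E³ → E³) (p : ℝ → E³ → ℝ),
      IsClassicalNSSolutionOnRegion (Ioo a 0 ×ˢ ball xc (4 * r)) 1 0 u p →
      (∀ t ∈ Ioo a 0, ∀ x ∈ ball xc (4 * r), ‖u t x‖ ≤ M) →
      (∀ t ∈ Ioo a 0, ∀ x ∈ ball xc (4 * r), |p t x| ≤ P) →
      ∃ u₀ : E³ → E³, DifferentiableOn ℝ u₀ (ball xc (2 * r)) ∧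
        TendstoUniformlyOn (fun t => u t) u₀ (𝓝[<] (0 : ℝ)) (ball xc (2 * r)) ∧
        TendstoUniformlyOn (fun t => fderiv ℝ (u t)) (fderiv ℝ u₀) (𝓝[<] (0 : ℝ)) (ball xc (2 * r))

/-- **PF-b `TerminalUniformRadius` (THE crux of PF, M; = the tree's BGK port `BGK2015.exists_small_unitScale_extension_norm_le`
with the time window DECOUPLED from the ball radius and the evaluation slice at the END of the scheme run — PF-AID §C/§D — then
scaled with `λ ≤ λ₀(M, P, r, a)` uniformly in `t` and glued over unit balls by `NSLocalAnalyticityRadiusCover`):** near the top,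
every slice `u(t)` extends holomorphically to ONE local complex tube over `B(x_c,2r)` of height `ρ`, with ONE bound `K`.
[why it might fail: not mathematically (BGK 2015 Thm 2.3 + (4.9) under the GUARD reading, lit §R157 (b)); the risk is the size of
the Literature-lane re-plumbing.] -/
def TerminalUniformRadius : Prop :=
  ∀ (xc : E³) (r a M P : ℝ), 0 < r → a < 0 → 0 ≤ M → 0 ≤ P →
    ∀ (u : ℝ → E³ → E³) (p : ℝ → E³ → ℝ),
      IsClassicalNSSolutionOnRegion (Ioo a 0 ×ˢ ball xc (4 * r)) 1 0 u p →
      (∀ t ∈ Ioo a 0, ∀ x ∈ ball xc (4 * r), ‖u t x‖ ≤ M) →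
      (∀ t ∈ Ioo a 0, ∀ x ∈ ball xc (4 * r), |p t x| ≤ P) →
      ∃ ρ K η : ℝ, 0 < ρ ∧ 0 < η ∧ ∀ t ∈ Ioo (-η) 0,
        ∃ U : EuclideanSpace ℂ (Fin 3) → EuclideanSpace ℂ (Fin 3),
          DifferentiableOn ℂ U (localComplexTube xc (2 * r) ρ) ∧
          (∀ z ∈ localComplexTube xc (2 * r) ρ, ‖U z‖ ≤ K) ∧
          ∀ x ∈ ball xc (2 * r), U (complexify x) = complexify (u t x)

/-- **PF-c `AnalyticOfBoundedHolomorphicLimit` (support, S; pure several complex variables — two-constants on the tube,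
`ScalingDefectPeepholeDoorThreeCircles.norm_le_two_constants_of_real_diameter`, + holomorphic limits,
`Literature.Analysis.Complex.SCV.differentiableOn_of_tendstoLocallyUniformlyOn`; Montel-free):** a family of maps holomorphic on a
fixed local tube with one bound, whose real restrictions converge uniformly on the real ball, has a real-analytic limit there.
[why it might fail: not expected to (Vitali's theorem in substance).] -/
def AnalyticOfBoundedHolomorphicLimit : Prop :=
  ∀ (xc : E³) (r ρ K η : ℝ), 0 < r → 0 < ρ → 0 < η →
    ∀ (U : ℝ → EuclideanSpace ℂ (Fin 3) → EuclideanSpace ℂ (Fin 3)) (v : ℝ → E³ → E³) (v₀ : E³ → E³),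
      (∀ t ∈ Ioo (-η) 0, DifferentiableOn ℂ (U t) (localComplexTube xc r ρ)) →
      (∀ t ∈ Ioo (-η) 0, ∀ z ∈ localComplexTube xc r ρ, ‖U t z‖ ≤ K) →
      (∀ t ∈ Ioo (-η) 0, ∀ x ∈ ball xc r, U t (complexify x) = complexify (v t x)) →
      TendstoUniformlyOn v v₀ (𝓝[<] (0 : ℝ)) (ball xc r) →
      AnalyticOnNhd ℝ v₀ (ball xc r)

/-- **PF from its three pieces** (classical logic + continuity of `curlCLM`). -/
theorem terminalSliceVelocityAnalyticity_of_split (hT : TerminalTraceC1) (hR : TerminalUniformRadius)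
    (hL : AnalyticOfBoundedHolomorphicLimit) : TerminalSliceVelocityAnalyticity := by
  intro xc r a M P hr ha hM hP u p hsol hu hp
  obtain ⟨u₀, hdiff, hcu, hcdu⟩ := hT xc r a M P hr ha hM hP u p hsol hu hp
  obtain ⟨ρ, K, η, hρ, hη, hU⟩ := hR xc r a M P hr ha hM hP u p hsol hu hp
  choose! U hUd hUb hUr using hU
  have hA : AnalyticOnNhd ℝ u₀ (ball xc (2 * r)) :=
    hL xc (2 * r) ρ K η (by positivity) hρ hη U u u₀ hUd hUb hUr hcu
  have hsub : ball xc r ⊆ ball xc (2 * r) := ball_subset_ball (by linarith)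
  refine ⟨u₀, hA.mono hsub, fun x hx => hcu.tendsto_at (hsub hx), fun x hx => ?_⟩
  have h1 : Tendsto (fun t => fderiv ℝ (u t) x) (𝓝[<] (0 : ℝ)) (𝓝 (fderiv ℝ u₀ x)) := hcdu.tendsto_at (hsub hx)
  have h2 : Tendsto (fun t => curlCLM (fderiv ℝ (u t) x)) (𝓝[<] (0 : ℝ)) (𝓝 (curlCLM (fderiv ℝ u₀ x))) :=
    (curlCLM.continuous.tendsto _).comp h1
  simpa [curl_eq_curlCLM_comp_fderiv'] using h2

/-- **K2 · TRACELESS SCAR LIOUVILLE (`TracelessScarLiouville`)** — VERBATIM the tree theorem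
`RellichScarApexLocalisationIrrotHalfspaceLiouville.not_isBackwardSingularPoint_of_topCurlVanishing_halfspace` (door S15's
K2Rep; ESS 2003 Thm 5.1 half-space backward uniqueness for the vorticity inequality + strip Liouville), universally
quantified: a rate-Type-I slab profile with `𝐈 < ⊤` and the apex bound, admitting on `(−1,0) × {⟪x,e⟫ > 0}` a continuous
representative whose curl fades at the top locally uniformly near every point of the half-space, is NOT backward singular at
the origin.  PROVED below (`tracelessScarLiouville_holds`). [EscauriazaSereginSverak2003 Thm 5.1; tree file above] -/
def TracelessScarLiouville : Prop :=
  ∀ (w : ℝ → E³ → E³) (π : ℝ → E³ → ℝ) (H : ℝ → E³ → E³ →L[ℝ] E³),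
    IsSuitableWeakSolutionOn 𝕊 1 0 w π → HasWeakSpatialGradientOn 𝕊 w H →
    typeIBound (Iio (0 : ℝ) ×ˢ univ) w π H < ⊤ → ∀ (C : ℝ),
    (∀ᵐ z ∂(volume.restrict (Iio (0 : ℝ) ×ˢ (univ : Set E³))), ‖w z.1 z.2‖ ≤ C / (‖z.2‖ + Real.sqrt (-z.1))) →
    ∀ (e : E³), ‖e‖ = 1 → ∀ (Uc : ℝ → E³ → E³),
    uncurry Uc =ᵐ[volume.restrict (Ioo (-1 : ℝ) 0 ×ˢ {x : E³ | 0 < ⟪x, e⟫})] uncurry w →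
    ContinuousOn (uncurry Uc) (Ioo (-1 : ℝ) 0 ×ˢ {x : E³ | 0 < ⟪x, e⟫}) →
    (∀ x₁ : E³, 0 < ⟪x₁, e⟫ → ∀ θ : ℝ, 0 < θ → ∃ s₀ δ : ℝ, s₀ < 0 ∧ (-1 : ℝ) ≤ s₀ ∧ 0 < δ ∧
      ∀ s ∈ Ioo s₀ 0, ∀ x ∈ ball x₁ δ, ‖curl (Uc s) x‖ ≤ θ) →
    ¬ IsBackwardSingularPoint w 0

/-- **K2 is a tree theorem** (door S15's K2Rep, landed): born with closer. -/
theorem tracelessScarLiouville_holds : TracelessScarLiouville :=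
  fun _w _π _H hsw hwg hI _C hapex _e he _Uc hUc hUcc htopc =>
    not_isBackwardSingularPoint_of_topCurlVanishing_halfspace hsw hwg hI hapex he hUc hUcc htopc


/-! ### §3 Tools for the compositions (the compositions themselves land in `QuietScarPocketDoorDoor.lean`) -/

/-- The punctured space `ℝ³∖{0}` is preconnected (`dim = 3 > 1`). -/
theorem isPreconnected_compl_zero : IsPreconnected ({0}ᶜ : Set E³) := by
  have h3 : 1 < Module.rank ℝ E³ := by
    rw [← Module.finrank_eq_rank, finrank_euclideanSpace_fin]
    exact_mod_cast (by norm_num : (1 : ℕ) < 3)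
  exact (isConnected_compl_singleton_of_one_lt_rank h3 (0 : E³)).isPreconnected

/-- **Identity-theorem step:** a trace real-analytic on `ℝ³∖{0}` vanishing on a pocket `B(e,κ)` (`‖e‖ = 1`, `0 < κ < 1`)
vanishes on `ℝ³∖{0}`. -/
theorem trace_eq_zero_of_pocket {Ω₀ : E³ → E³} (hΩ : AnalyticOnNhd ℝ Ω₀ ({0}ᶜ : Set E³)) {e : E³} (he : ‖e‖ = 1)
    {κ : ℝ} (hκ : 0 < κ) (hκ1 : κ < 1) (hpocket : ∀ y ∈ ball e κ, Ω₀ y = 0) :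
    EqOn Ω₀ 0 ({0}ᶜ : Set E³) := by
  have he0 : e ∈ ({0}ᶜ : Set E³) := by
    intro h
    have : ‖e‖ = 0 := by rw [mem_singleton_iff.1 h, norm_zero]
    linarith
  have hev : Ω₀ =ᶠ[𝓝 e] 0 :=
    Filter.eventuallyEq_iff_exists_mem.2 ⟨ball e κ, ball_mem_nhds e hκ, fun y hy => hpocket y hy⟩
  exact hΩ.eqOn_zero_of_preconnected_of_eventuallyEq_zero isPreconnected_compl_zero he0 hev


/-- **Sanity (the door is not vacuous in its quantifiers): the pocket hypothesis of `PVScarPocketRegularityAt` is satisfied by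
every field whose curl vanishes identically near the top** (e.g. the irrotational parasites `u = a(t)∇φ`) — for those the
door's conclusion must, and does, hold in the class (one-point Type I off the apex forces `a` bounded; recorded in the memo's
parasite check, not formalised here). -/
theorem pocket_of_curl_eventually_zero {u : ℝ → E³ → E³} {x₁ : E³} {κ ε : ℝ} (hε : 0 ≤ ε)
    (h : ∀ x ∈ ball x₁ (κ * ‖x₁‖), ∀ᶠ t in 𝓝[<] (0 : ℝ), curl (u t) x = 0) :
    ∀ x ∈ ball x₁ (κ * ‖x₁‖), ∀ᶠ t in 𝓝[<] (0 : ℝ), ‖x₁‖ ^ 2 * ‖curl (u t) x‖ ≤ ε := fun x hx =>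
  (h x hx).mono fun t ht => by simp [ht, hε]

end Summit.NavierStokesRegularity.NavierStokesRegularity.Theorems.QuietScarPocketDoor

end
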